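import Literature.AnabelianGeometry.EtaleTheta.RemarksSec3

/-!
# [EtTh] §3, Remark 3.7.1 — PROVED: the (in)dissectibility types of the base category `D` pass to
# the tempered Frobenioid `C`

Mochizuki, *The étale theta function and its Frobenioid-theoretic manifestations*, Publ. RIMS **45**
(2009), §3, Remark 3.7.1, PRIMS PDF p. 80 (printed 306) [cite: MochizukiEtTh2009, Rmk 3.7.1 p.80]:
"We recall [cf. [FrdII], §0] in passing that if `D` is of weakly indissectible (respectively,
strongly dissectible; weakly dissectible) type, then so is `C`."

PROOF-ONLY companion (theorems only, no definitions) of `RemarksSec3.lean` (abc-iut-L2-t3 /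
abc-iut-L6-t12), which types the Remark as the named predicate `TemperedFrobenioid.Remark371`
(FACT-LIST F-1309, DAG node `EtTh:Rmk3.7.1`).  Here `remark371_holds : C₀.Remark371` is proved for
EVERY tempered Frobenioid `C₀ : TemperedFrobenioid T D VD`, the Frobenioid `C = C₀.category` being the
model Frobenioid of [FrdI] Thm. 5.2 (i) on the data `(D, Φ, B, B → Φ^gp)` (`TemperedFrobenioidModel.lean`),
and the (in)dissectibility types being those of [FrdII] §0 (`Frobenioids/Dissection.lean`)
[cite: MochizukiFrdII2008, §0 p.5].

The argument (elementary; [FrdII] §0 "recalls" it without proof):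
* LIFTING.  Over any `W ∈ Ob(D)` with arrows `fᵢ : W → Base(Xᵢ)` (`i = 0, 1`) to the bases of two
  objects `X₀, X₁` of `C` there is an object `Z = (W, β)` of `C` with arrows `Z → X₀`, `Z → X₁` of
  Frobenius degree `1`: write `Φ(fᵢ)(cls Xᵢ) = aᵢ/bᵢ` in `Φ(W)^gp` and take `β := 1/(b₀b₁)`, zero
  divisors `a₀b₁`, `a₁b₀`, unit components `1` (`ModelFrobenioid.exists_nonempty_over`).  Dually, arrows
  `gᵢ : Yᵢ → Base(A)` lift to degree-`1` arrows `(Yᵢ, 1/bᵢ) → A` (`ModelFrobenioid.exists_lift_pair`).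
* NON-INITIALITY.  An object `(W, 1/b)` with `b ∈ Φ(W)` is MOBILE — it carries the endomorphism
  `(deg_Fr = 2, id, b, 1)` besides the identity — hence non-initial
  (`ModelFrobenioid.isMobile_of_cls_mul_of_eq_one`, via the tree's `IsMobile.isNonemptyObj`).
* WEAKLY INDISSECTIBLE.  A strongly dissecting pair `Xᵢ → A` in `C` would give the pair
  `Base(Xᵢ) → Base(A)` in `D`, which is not strongly dissecting (D is of weakly indissectible type):
  either some `Base(Xᵢ)` is initial or some object of `D` maps to both bases — in both cases some
  `W` maps to both bases, and LIFTING + NON-INITIALITY contradict the strong dissection in `C`.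
  (No hypothesis on `D` is used.)
* DISSECTIBLE clauses.  In a TOTALLY EPIMORPHIC category an object mapping to an initial object is
  initial (`IsTotallyEpimorphic.isNonemptyObj_of_hom`); so a totally epimorphic `D` of strongly /
  weakly dissectible type has NO initial object, every `Base(Z)` is non-initial, and a dissecting
  pair `Yᵢ → Base(A)` in `D` lifts (LIFTING) to a dissecting pair in `C`: arrows `Z → Xᵢ` in `C`
  project to arrows `Base(Z) → Yᵢ` (resp. an equality `ψ₀ ≫ φ₀ = ψ₁ ≫ φ₁` in `C` projects to one in
  `D`).  Total epimorphicity of `D` is part of the data of a tempered Frobenioid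
  (`TemperedFrobenioid.isTotallyEpimorphic`, Def. 3.6 (ii) p.76).

Seat abc-iut-w5-d135 (gen 2), discharge of F-1309.  HONEST FRAMING: an elementary categorical
remark; nothing here bears on [IUTchIII] Cor. 3.12; typed ≠ proved elsewhere, proved here.
-/

namespace Literature.AlgebraicGeometry.Frobenioids

open CategoryTheory CategoryTheory.Limits Opposite

universe w v u

/-! ## Two general facts: fractions in `M^gp`; maps to initial objects in totally epimorphic categories -/

/-- Every element of the Grothendieck group `M^gp` of a commutative monoid is a fraction `a/b`:
`z · b = a` for some `a, b ∈ M` (private helper). [folklore] -/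
private theorem GrothendieckGroup.exists_mul_of_eq_of {M : Type*} [CommMonoid M]
    (z : Algebra.GrothendieckGroup M) :
    ∃ a b : M, z * Algebra.GrothendieckGroup.of b = Algebra.GrothendieckGroup.of a := by
  induction z using Localization.induction_on with
  | H y =>
    refine ⟨y.1, y.2, ?_⟩
    rw [Localization.mk_eq_monoidOf_mk'_apply]
    exact Submonoid.LocalizationMap.mk'_spec _ _ _

/-- In a totally epimorphic category ([FrdI] §0), an object `P` admitting an arrow `P → I` to an
INITIAL object `I` is itself initial (the arrow is inverse to `I → P`, the latter being epi);
contrapositively: a non-initial `P` only maps to non-initial objects. [cite: MochizukiFrdI2008, §0 p.15] -/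
theorem IsTotallyEpimorphic.isNonemptyObj_of_hom {C : Type u} [Category.{v} C]
    (hC : IsTotallyEpimorphic C) {P I : C} (f : P ⟶ I) (hP : IsNonemptyObj P) :
    IsNonemptyObj I := by
  refine ⟨fun hI => hP.false (hI.ofIso ⟨hI.to P, f, hI.hom_ext _ _, ?_⟩)⟩
  haveI : Epi (hI.to P) := hC.epi _
  rw [← cancel_epi (hI.to P), ← Category.assoc, hI.hom_ext (hI.to P ≫ f) (𝟙 I), Category.id_comp,
    Category.comp_id]

/-- A totally epimorphic category of strongly dissectible type has no initial object: every object
is non-initial ("nonempty"). [cite: MochizukiFrdII2008, §0 p.5] -/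
theorem IsTotallyEpimorphic.isNonemptyObj_of_isOfStronglyDissectibleType {C : Type u} [Category.{v} C]
    (hC : IsTotallyEpimorphic C) (h : IsOfStronglyDissectibleType C) (I : C) : IsNonemptyObj I := by
  obtain ⟨X, φ, hX, -⟩ := h.isStronglyDissectible I
  exact hC.isNonemptyObj_of_hom (φ 0) (hX 0)

/-- A totally epimorphic category of weakly dissectible type has no initial object: every object
is non-initial ("nonempty"). [cite: MochizukiFrdII2008, §0 p.5] -/
theorem IsTotallyEpimorphic.isNonemptyObj_of_isOfWeaklyDissectibleType {C : Type u} [Category.{v} C]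
    (hC : IsTotallyEpimorphic C) (h : IsOfWeaklyDissectibleType C) (I : C) : IsNonemptyObj I := by
  obtain ⟨X, φ, hX, -⟩ := h.isWeaklyDissectible I
  exact hC.isNonemptyObj_of_hom (φ 0) (hX 0)

/-! ## Lifting arrows of `D` to the model Frobenioid of [FrdI] Thm. 5.2 (i) -/

namespace ModelFrobenioid

variable {D : Type u} [Category.{v} D] {Φ B : Dᵒᵖ ⥤ CommMonCat.{w}} {DivB : B ⟶ monoidGp Φ}

/-- An object `(W, β)` of the model Frobenioid with `β · b = 1` for some `b ∈ Φ(W)` is MOBILE: besides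
the identity it has the endomorphism `(deg_Fr = 2, id_W, Div = b, u = 1)` (relation (d):
`β² · b = β`). [cite: MochizukiFrdI2008, Thm. 5.2(i) p.100] -/
theorem isMobile_of_cls_mul_of_eq_one (X : ModelFrobenioid Φ B DivB) (b : Φ.obj (op X.base))
    (hb : X.cls * Algebra.GrothendieckGroup.of b = 1) : IsMobile X := by
  refine ⟨X, 𝟙 X, { degFr := 2, base := 𝟙 X.base, div := b, unit := 1, rel := ?_ }, fun h => ?_⟩
  · rw [pullGp_id, map_one, mul_one]
    change X.cls ^ 2 * Algebra.GrothendieckGroup.of b = X.cls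
    rw [pow_two, mul_assoc, hb, mul_one]
  · have h1 : (1 : ℕ+) = 2 := congrArg degFr h
    exact absurd h1 (by decide)

/-- An object `(W, β)` with `β · b = 1`, `b ∈ Φ(W)`, is non-initial ("nonempty").
[cite: MochizukiFrdI2008, Thm. 5.2(i) p.100] -/
theorem isNonemptyObj_of_cls_mul_of_eq_one (X : ModelFrobenioid Φ B DivB) (b : Φ.obj (op X.base))
    (hb : X.cls * Algebra.GrothendieckGroup.of b = 1) : IsNonemptyObj X :=
  (isMobile_of_cls_mul_of_eq_one X b hb).isNonemptyObj

/-- LIFTING, downward form: arrows `f₀ : W → Base(X₀)`, `f₁ : W → Base(X₁)` of `D` lift to arrows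
`Z → X₀`, `Z → X₁` of the model Frobenioid out of a NON-INITIAL object `Z = (W, 1/(b₀b₁))`, where
`Φ(fᵢ)(cls Xᵢ) = aᵢ/bᵢ`. [cite: MochizukiFrdI2008, Thm. 5.2(i) p.100] -/
theorem exists_nonempty_over (X₀ X₁ : ModelFrobenioid Φ B DivB) {W : D} (f₀ : W ⟶ X₀.base)
    (f₁ : W ⟶ X₁.base) :
    ∃ Z : ModelFrobenioid Φ B DivB, IsNonemptyObj Z ∧ Nonempty (Z ⟶ X₀) ∧ Nonempty (Z ⟶ X₁) := by
  obtain ⟨a₀, b₀, h₀⟩ := GrothendieckGroup.exists_mul_of_eq_of (pullGp Φ f₀ X₀.cls)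
  obtain ⟨a₁, b₁, h₁⟩ := GrothendieckGroup.exists_mul_of_eq_of (pullGp Φ f₁ X₁.cls)
  refine ⟨⟨W, (Algebra.GrothendieckGroup.of (b₀ * b₁))⁻¹⟩,
    isNonemptyObj_of_cls_mul_of_eq_one _ (b₀ * b₁) (inv_mul_cancel _),
    ⟨{ degFr := 1, base := f₀, div := a₀ * b₁, unit := 1, rel := ?_ }⟩,
    ⟨{ degFr := 1, base := f₁, div := a₁ * b₀, unit := 1, rel := ?_ }⟩⟩
  · rw [PNat.one_coe, pow_one, map_one, mul_one, map_mul, map_mul, ← h₀, mul_assoc (pullGp Φ f₀ X₀.cls),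
      mul_comm (pullGp Φ f₀ X₀.cls), inv_mul_cancel_left]
  · rw [PNat.one_coe, pow_one, map_one, mul_one, map_mul, map_mul, ← h₁, mul_assoc (pullGp Φ f₁ X₁.cls),
      mul_comm (Algebra.GrothendieckGroup.of b₁) (Algebra.GrothendieckGroup.of b₀),
      mul_comm (pullGp Φ f₁ X₁.cls), inv_mul_cancel_left]

/-- LIFTING, upward form: a pair of arrows `gᵢ : Yᵢ → Base(A)` of `D` lifts to a pair of degree-`1`
arrows `φᵢ : Xᵢ = (Yᵢ, 1/bᵢ) → A` of the model Frobenioid (`Φ(gᵢ)(cls A) = aᵢ/bᵢ`) with `Xᵢ`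
NON-INITIAL; arrows `Z → Xᵢ` project to arrows `Base(Z) → Yᵢ`, and an equality
`ψᵢ ≫ φᵢ = ψⱼ ≫ φⱼ` projects to `Base(ψᵢ) ≫ gᵢ = Base(ψⱼ) ≫ gⱼ`. [cite: MochizukiFrdI2008, Thm. 5.2(i) p.100] -/
theorem exists_lift_pair (A : ModelFrobenioid Φ B DivB) (Y : Fin 2 → D) (g : ∀ i, Y i ⟶ A.base) :
    ∃ (X : Fin 2 → ModelFrobenioid Φ B DivB) (φ : ∀ i, X i ⟶ A),
      (∀ i, IsNonemptyObj (X i)) ∧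
      (∀ i (Z : ModelFrobenioid Φ B DivB), (Z ⟶ X i) → Nonempty (Z.base ⟶ Y i)) ∧
      (∀ i j (Z : ModelFrobenioid Φ B DivB) (ψi : Z ⟶ X i) (ψj : Z ⟶ X j),
        ψi ≫ φ i = ψj ≫ φ j → ∃ (χi : Z.base ⟶ Y i) (χj : Z.base ⟶ Y j), χi ≫ g i = χj ≫ g j) := by
  have hz : ∀ i, ∃ ab : Φ.obj (op (Y i)) × Φ.obj (op (Y i)),
      pullGp Φ (g i) A.cls * Algebra.GrothendieckGroup.of ab.2 = Algebra.GrothendieckGroup.of ab.1 :=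
    fun i => by
      obtain ⟨a, b, h⟩ := GrothendieckGroup.exists_mul_of_eq_of (pullGp Φ (g i) A.cls)
      exact ⟨(a, b), h⟩
  choose ab hab using hz
  refine ⟨fun i => ⟨Y i, (Algebra.GrothendieckGroup.of (ab i).2)⁻¹⟩,
    fun i => { degFr := 1, base := g i, div := (ab i).1, unit := 1, rel := ?_ }, ?_, ?_, ?_⟩
  · rw [PNat.one_coe, pow_one, map_one, mul_one, ← hab i, mul_comm (pullGp Φ (g i) A.cls),
      inv_mul_cancel_left]
  · exact fun i => isNonemptyObj_of_cls_mul_of_eq_one _ (ab i).2 (inv_mul_cancel _)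
  · exact fun i Z ψ => ⟨baseMap ψ⟩
  · exact fun i j Z ψi ψj h => ⟨baseMap ψi, baseMap ψj, congrArg baseMap h⟩

end ModelFrobenioid

end Literature.AlgebraicGeometry.Frobenioids

namespace Literature.AnabelianGeometry.EtaleTheta

open CategoryTheory CategoryTheory.Limits Opposite Literature.AlgebraicGeometry.Frobenioids

universe u₀ v₀ u v w

namespace TemperedFrobenioid

variable {D₀ : Type u₀} [Category.{v₀} D₀] {V : FrdIMonoidStub.{w}}
  {T : RealifiedDivisorMonoids (D₀ := D₀) V} {D : Type u} [Category.{v} D]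
  {VD : FrdICatStub.{u, v, w} D} (C₀ : TemperedFrobenioid T D VD)

/-- **Remark 3.7.1, first clause** (p. 80): if `D` is of weakly indissectible type, then so is the
tempered Frobenioid `C` — proved for the model Frobenioid over ANY base category (no hypothesis on
`D` is used). [cite: MochizukiEtTh2009, Rmk 3.7.1 p.80] -/
theorem isOfWeaklyIndissectibleType_category (hD : IsOfWeaklyIndissectibleType D) :
    IsOfWeaklyIndissectibleType C₀.category := by
  refine ⟨fun A => ?_⟩
  rintro ⟨X, φ, -, hXsd⟩
  have key : ∀ W : D, (W ⟶ (X 0).base) → (W ⟶ (X 1).base) → False := by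
    intro W f₀ f₁
    obtain ⟨Z, hZ, hZ₀, hZ₁⟩ := ModelFrobenioid.exists_nonempty_over (X 0) (X 1) f₀ f₁
    exact hXsd (show (0 : Fin 2) ≠ 1 by decide) hZ ⟨hZ₀, hZ₁⟩
  refine hD.isWeaklyIndissectible A.base
    ⟨fun i => (X i).base, fun i => ModelFrobenioid.baseMap (φ i), fun i => ⟨fun hI => ?_⟩, ?_⟩
  · exact key _ (hI.to _) (hI.to _)
  · rintro i j hij W - ⟨⟨fi⟩, ⟨fj⟩⟩
    fin_cases i <;> fin_cases j
    · exact hij rfl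
    · exact key W fi fj
    · exact key W fj fi
    · exact hij rfl

/-- **Remark 3.7.1, second clause** (p. 80): if `D` is of strongly dissectible type, then so is the
tempered Frobenioid `C` (uses: `D` totally epimorphic, Def. 3.6 (ii)). [cite: MochizukiEtTh2009, Rmk 3.7.1 p.80] -/
theorem isOfStronglyDissectibleType_category (hD : IsOfStronglyDissectibleType D) :
    IsOfStronglyDissectibleType C₀.category := by
  refine ⟨fun A => ?_⟩
  obtain ⟨Y, g, -, hYsd⟩ := hD.isStronglyDissectible A.base
  obtain ⟨X, φ, hXne, hXb, -⟩ := ModelFrobenioid.exists_lift_pair A Y g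
  refine ⟨X, φ, hXne, ?_⟩
  rintro i j hij Z - ⟨⟨ψi⟩, ⟨ψj⟩⟩
  exact hYsd hij (C₀.isTotallyEpimorphic.isNonemptyObj_of_isOfStronglyDissectibleType hD Z.base)
    ⟨hXb i Z ψi, hXb j Z ψj⟩

/-- **Remark 3.7.1, third clause** (p. 80): if `D` is of weakly dissectible type, then so is the
tempered Frobenioid `C` (uses: `D` totally epimorphic, Def. 3.6 (ii)). [cite: MochizukiEtTh2009, Rmk 3.7.1 p.80] -/
theorem isOfWeaklyDissectibleType_category (hD : IsOfWeaklyDissectibleType D) :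
    IsOfWeaklyDissectibleType C₀.category := by
  refine ⟨fun A => ?_⟩
  obtain ⟨Y, g, -, hYwd⟩ := hD.isWeaklyDissectible A.base
  obtain ⟨X, φ, hXne, -, hXeq⟩ := ModelFrobenioid.exists_lift_pair A Y g
  refine ⟨X, φ, hXne, ?_⟩
  intro i j hij Z _ ψi ψj heq
  obtain ⟨χi, χj, hχ⟩ := hXeq i j Z ψi ψj heq
  exact hYwd hij (C₀.isTotallyEpimorphic.isNonemptyObj_of_isOfWeaklyDissectibleType hD Z.base) χi χj hχ

/-- **Remark 3.7.1** (p. 80), PROVED: the named predicate `TemperedFrobenioid.Remark371` of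
`RemarksSec3.lean` holds for every tempered Frobenioid — "if `D` is of weakly indissectible
(respectively, strongly dissectible; weakly dissectible) type, then so is `C`" (discharge of
FACT-LIST F-1309). [cite: MochizukiEtTh2009, Rmk 3.7.1 p.80] -/
theorem remark371_holds : C₀.Remark371 :=
  ⟨C₀.isOfWeaklyIndissectibleType_category, C₀.isOfStronglyDissectibleType_category,
    C₀.isOfWeaklyDissectibleType_category⟩

end TemperedFrobenioid

end Literature.AnabelianGeometry.EtaleTheta
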